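import Summits.Ventures.YMGap.RobustBall.TransferGap
import Summits.Ventures.YMGap.Thresholds.StarMassGapSUN
import HarnessLib

/-!
# Robust ball (Y2) — the infinite-volume transfer-matrix gap: `SU(3)` and every-`SU(N)` hypothesis-free cells

HONEST FRAMING: venture file of the cell `pub-ymgap` (QuantumFields programme), track ROBUST-BALL, seat rb-p2 (g12); cells of
`TransferGap.exists_hasInfiniteVolumeGap_of_massGapAt` (the spectral gap `HasInfiniteVolumeGap` of the infinite-volume lattice theory from the
cell's Euclidean `MassGapAt`).  LATTICE statements at STRONG COUPLING with an EXISTENTIAL rate (the Shen–Zhu–Zhu / Dobrushin clustering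
rate of `MassGapAt`); nothing about `β → ∞`, a continuum limit, or Clay.
* ★★ `suN_exists_hasInfiniteVolumeGap` — EVERY `SU(N)`, `N ≥ 2`, 't Hooft `0 ≤ x ≤ 9/308` (the cell's star window, `massGapAt_SU_star`): the
  infinite-volume theory at tree coupling `N x` is Osterwalder–Schrader reconstructible along the odd tori and its transfer matrix has a
  spectral gap, `∃ m > 0, HasInfiniteVolumeGap (fundamentalLatticeRep N) (N x) m`;
* ★★ `su3_exists_hasInfiniteVolumeGap` — `SU(3)`, `d = 4`, `0 ≤ β_W ≤ 81/308` (tree coupling `β_W/3`, `su3_massGapAt_le`);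
* the odd-torus limit states are exactly the unique DLR state in both cases (`TransferGap.oddTorusLimitPoints_eq_singleton_of_massGapAt`).
0 sorry, 0 definitions.  References: Osterwalder–Seiler 1978 §2; Glimm–Jaffe 1987 §6.1.  Everything here is proved. [folklore]
-/

noncomputable section

open Literature.MathematicalPhysics.QuantumFieldTheory Literature.MathematicalPhysics.QuantumLattice

namespace Summit.Ventures.YMGap.RobustBall.TransferGap

/-- ★★ **EVERY `SU(N)`, `N ≥ 2`, `d = 4`, HYPOTHESIS-FREE, 't Hooft `0 ≤ x ≤ 9/308`: an infinite-volume transfer-matrix gap**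
`∃ m > 0, HasInfiniteVolumeGap (fundamentalLatticeRep N) (N x) m` (star window `massGapAt_SU_star`). [folklore] -/
theorem suN_exists_hasInfiniteVolumeGap {N : ℕ} (hN : 2 ≤ N) {x : ℝ} (hx0 : 0 ≤ x) (hx : x ≤ 9 / 308) :
    ∃ m : ℝ, 0 < m ∧ HasInfiniteVolumeGap (fundamentalLatticeRep N) ((N : ℝ) * x) m :=
  exists_hasInfiniteVolumeGap_of_massGapAt (by omega) hx0 (StarSUNLimit.massGapAt_SU_star hN (by rw [abs_of_nonneg hx0]; exact hx))

/-- ★★ **`SU(3)`, `d = 4`, HYPOTHESIS-FREE, `0 ≤ β_W ≤ 81/308` (tree coupling `β_W/3`): an infinite-volume transfer-matrix gap**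
`∃ m > 0, HasInfiniteVolumeGap (fundamentalLatticeRep 3) (β_W/3) m`, and the odd-torus limit states are the unique DLR state. [folklore] -/
theorem su3_exists_hasInfiniteVolumeGap {βW : ℝ} (h0 : 0 ≤ βW) (h : βW ≤ 81 / 308) :
    ∃ m : ℝ, 0 < m ∧ HasInfiniteVolumeGap (fundamentalLatticeRep 3) (βW / 3) m ∧
      ∃ μ : MeasureTheory.Measure (LGConfig 4 (Matrix.specialUnitaryGroup (Fin 3) ℂ)),
        Literature.MathematicalPhysics.QuantumLattice.IsInfiniteVolumeLimit (d := 4) (fundamentalRep (Fin 3)) (βW / 3) μ ∧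
          ymGibbsMeasures (d := 4) (fundamentalRep (Fin 3)) (βW / 3) = {μ} ∧
            oddTorusLimitPoints (fundamentalLatticeRep 3) (βW / 3) = {μ} := by
  have hgap : MassGapAt 4 3 (βW / 9) := StarSUNLimit.su3_massGapAt_le (by rw [abs_of_nonneg h0]; exact h)
  have e : (((3 : ℕ) : ℝ)) * (βW / 9) = βW / 3 := by push_cast; ring
  obtain ⟨m, hm, hIV⟩ := exists_hasInfiniteVolumeGap_of_massGapAt (N := 3) (by norm_num) (by positivity) hgap
  obtain ⟨μ, hlim, hG, hodd⟩ := oddTorusLimitPoints_eq_singleton_of_massGapAt (N := 3) hgap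
  rw [e] at hIV hlim hG hodd
  exact ⟨m, hm, hIV, μ, hlim, hG, hodd⟩

end Summit.Ventures.YMGap.RobustBall.TransferGap

end
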